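import Mathlib

/-!
# PneNP / ExpanderLinearGenerators — substitution barriers for the expansion-scale law, II:
# the potential form (stmt-PneNP-11442, supports)

Companion of `…SubstitutionBarriers` (cover lemma, image-distance barrier); notation as there:
target `A x = b` over `𝔽₂`, graph Tseitin `B y = ch`, affine substitution `x ↦ M y + c` in
consequence form `A M = P B`, `b + A c = P ch`, rows of `P` of weight `≤ w`, rows of `A` of weight
`≤ ℓ`.

* `SubstitutionBarrier.potentialForm_exists_large_row` — **barrier II, potential form**: if
  the target is minimally unsolvable (`𝟙ᵀ A = 0`: every variable in an even number of rows;
  `𝟙ᵀ b = 1`) and the substitution matrix factors through the incidence matrix, `M = N B` — which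
  the memo `memo-11442-s17-substitution-barriers.md` (item evidence) shows is forced, after
  localising to a sub-grid, whenever the kernel code `ker A` has large distance (two-sided
  expanders: random LDPC-type systems) — then some variable `x_j` is sent to the cut of a vertex
  set `{u | N j u ≠ 0}` of size `≥ (|V| − w)/ℓ`.
* `SubstitutionBarrier.halfNormalise` — rows of `N` may be complemented without changing `N B`,
  so that set may be assumed to have size `≤ |V|/2`; with the edge-isoperimetric inequality of
  the host graph (grid `k × k`: `≥ min(2√s, k)` boundary edges for `s ≤ k²/2`) the congestion of
  the substitution is `≥ 2k/√ℓ − O(√w)`, which makes the transferred grid lower bound vacuous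
  (memo, Theorem E: `t ≥ c (δ/ℓ)^{1/3} k^{2/3}` in general for kernel distance `δ n`).
* `SubstitutionBarrier.potentialForm_exists_balanced_large_row_graph` — the same with `B` the
  `ZMod 2` incidence matrix of a connected `SimpleGraph`, the two algebraic hypotheses on `B`
  (`d ᵥ* B = 0 →` `d` constant; `𝟙 ᵥ* B = 0`) being discharged by
  `incMatrix_vecMul_eq_zero_const` and `sum_incMatrix_col_eq_zero`.

References: J. Krajíček, *Proof complexity* (CUP 2019), §13.4, Problem 19.4.5; J. Håstad,
J. ACM 68 (2021); N. Galesi, D. Itsykson, A. Riazanov, A. Sofronova, APAL 174 (2023).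
-/

namespace Summit.PneNP.PneNP.Theorems

set_option linter.dupNamespace false -- `Summit.PneNP.PneNP.…`: summit = sub-problem (D-0017)

open Finset Matrix

namespace SubstitutionBarrier

variable {ι κ V Eh : Type*}

/-! ### A summation helper -/

/-- Column sums zero (`𝟙ᵀ A = 0`) make every image vector `A x` have coordinate sum zero. -/
theorem sum_mulVec_eq_zero_of_colsum [Fintype ι] [Fintype κ] (A : Matrix ι κ (ZMod 2))
    (hA : ∀ j, ∑ i, A i j = 0)
    (x : κ → ZMod 2) : ∑ i, (A *ᵥ x) i = 0 := by
  simp only [Matrix.mulVec, dotProduct]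
  rw [Finset.sum_comm]
  refine Finset.sum_eq_zero fun j _ => ?_
  rw [← Finset.sum_mul, hA j, zero_mul]

/-! ### Barrier II: potential form -/

/-- **Half-normalisation.** If `𝟙 ᵥ* B = 0` (every column of `B` has an even number of ones —
every edge has two ends) then complementing any set of rows of `N` does not change `N * B`; in
particular one may assume every row of `N` is supported on at most half of `V`. -/
theorem halfNormalise [Fintype V] (B : Matrix V Eh (ZMod 2)) (N : Matrix κ V (ZMod 2))
    (hBcol : ∀ e, ∑ u, B u e = 0) :
    ∃ N' : Matrix κ V (ZMod 2), N' * B = N * B ∧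
      ∀ j, 2 * (univ.filter fun u => N' j u ≠ 0).card ≤ Fintype.card V := by
  classical
  refine ⟨Matrix.of fun j u =>
      if 2 * (univ.filter fun u => N j u ≠ 0).card ≤ Fintype.card V then N j u else N j u + 1,
    ?_, ?_⟩
  · ext j e
    simp only [Matrix.mul_apply, Matrix.of_apply]
    by_cases hj : 2 * (univ.filter fun u => N j u ≠ 0).card ≤ Fintype.card V
    · simp [hj]
    · simp only [hj, if_false, add_mul, one_mul, Finset.sum_add_distrib, hBcol e, add_zero]
  · intro j
    by_cases hj : 2 * (univ.filter fun u => N j u ≠ 0).card ≤ Fintype.card V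
    · simp [Matrix.of_apply, hj]
    · have hflip : (univ.filter fun u => (Matrix.of fun j u =>
          if 2 * (univ.filter fun u => N j u ≠ 0).card ≤ Fintype.card V then N j u
          else N j u + 1) j u ≠ 0) = (univ.filter fun u => ¬ (N j u ≠ 0)) := by
        ext u
        simp only [mem_filter, mem_univ, true_and, Matrix.of_apply, hj, if_false, not_not]
        rcases (by decide : ∀ x : ZMod 2, x = 0 ∨ x = 1) (N j u) with h | h
        · simp [h]
        · simp only [h, one_ne_zero, iff_false, not_not]; decide
      rw [hflip]
      have hsum := Finset.card_filter_add_card_filter_not (s := (univ : Finset V))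
        (p := fun u => N j u ≠ 0)
      rw [Finset.card_univ] at hsum
      push Not at hj
      omega

/-- **Barrier II, potential form.** Consequence form `A N B = P B`, `b + A c = P ch` with the
substitution matrix factoring through `B` (`M = N B`), for a MINIMALLY UNSOLVABLE target
(`𝟙ᵀ A = 0`: every variable occurs in an even number of rows; `𝟙ᵀ b = 1`), an odd total charge
`𝟙ᵀ ch = 1`, a "connected" `B` (`d ᵥ* B = 0` only for constant `d`), rows of `A` of weight `≤ ℓ`
and rows of `P` of weight `≤ w < |V|`. Then some variable `j` has `|V| ≤ ℓ · |{u | N j u ≠ 0}| + w`: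
under the substitution, `x_j` becomes the cut of a vertex set of size at least `(|V| − w)/ℓ`.
Proof: `(A N + P) B = 0` makes every row of `A N + P` a constant `q_i`; summing
`b + A c = P ch = A N ch + q` over all rows gives `𝟙ᵀ q = 𝟙ᵀ b = 1`, so some `q_i = 1`, i.e. row
`i` of `A N` is `1` off the `≤ w` vertices of `W_i`; that row is the sum of the `≤ ℓ` rows `N j`,
`j ∈ supp(A i)`. Combine with `halfNormalise` and the edge-isoperimetric profile of the host graph
(grid `k × k`: cuts of sets of size between `(k² − w)/ℓ` and `k²/2` have `≥ 2k/√ℓ − O(√w)` edges) to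
bound the congestion of the substitution from below. -/
theorem potentialForm_exists_large_row [Fintype ι] [Fintype κ] [Fintype V] [DecidableEq V]
    (A : Matrix ι κ (ZMod 2)) (b : ι → ZMod 2)
    (c : κ → ZMod 2) (B : Matrix V Eh (ZMod 2)) (ch : V → ZMod 2) (P : Matrix ι V (ZMod 2))
    (N : Matrix κ V (ZMod 2)) (ℓ w : ℕ)
    (hA : ∀ j, ∑ i, A i j = 0) (hb : ∑ i, b i = 1) (hch : ∑ u, ch u = 1)
    (hconn : ∀ d : V → ZMod 2, d ᵥ* B = 0 → ∀ u v, d u = d v)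
    (hCF1 : A * N * B = P * B) (hCF2 : b + A *ᵥ c = P *ᵥ ch)
    (hrow : ∀ i, (univ.filter fun j => A i j ≠ 0).card ≤ ℓ)
    (hW : ∀ i, (univ.filter fun u => P i u ≠ 0).card ≤ w)
    (hV : w < Fintype.card V) :
    ∃ j, Fintype.card V ≤ ℓ * (univ.filter fun u => N j u ≠ 0).card + w := by
  classical
  -- V is nonempty
  have hVne : Nonempty V := by
    rw [← Fintype.card_pos_iff]; omega
  obtain ⟨u₀⟩ := hVne
  -- D := A N + P has D B = 0, hence constant rows
  set Dm : Matrix ι V (ZMod 2) := A * N + P with hDm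
  have hDB : Dm * B = 0 := by
    rw [hDm, Matrix.add_mul, hCF1]
    funext i e
    simp [CharTwo.add_self_eq_zero]
  have hconst : ∀ i u, Dm i u = Dm i u₀ := by
    intro i u
    refine hconn (fun v => Dm i v) ?_ u u₀
    funext e
    have := congrFun (congrFun hDB i) e
    simpa [Matrix.mul_apply, Matrix.vecMul, dotProduct] using this
  set q : ι → ZMod 2 := fun i => Dm i u₀ with hq
  -- P = A N + q 𝟙ᵀ entrywise
  have hP : ∀ i u, P i u = (A * N) i u + q i := by
    intro i u
    have h1 : Dm i u = (A * N) i u + P i u := by simp [hDm, Matrix.add_apply]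
    have h2 := hconst i u
    rw [h1] at h2
    -- P i u = (A N) i u + Dm i u₀  since x = y + P ⇒ P = y + x in char 2
    have : P i u = (A * N) i u + ((A * N) i u + P i u) := by
      rw [← add_assoc, CharTwo.add_self_eq_zero, zero_add]
    rw [this, h2]
  -- sum of q over rows is 1
  have hsumq : ∑ i, q i = 1 := by
    have hrows : ∀ i, b i + (A *ᵥ c) i = (A *ᵥ (N *ᵥ ch)) i + q i := by
      intro i
      have := congrFun hCF2 i
      simp only [Pi.add_apply] at this
      rw [this]
      simp only [Matrix.mulVec, dotProduct]
      rw [show (∑ u, P i u * ch u) = ∑ u, ((A * N) i u * ch u + q i * ch u) from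
        Finset.sum_congr rfl fun u _ => by rw [hP i u, add_mul]]
      rw [Finset.sum_add_distrib, ← Finset.mul_sum, hch, mul_one]
      congr 1
      simp only [Matrix.mul_apply, Finset.sum_mul]
      rw [Finset.sum_comm]
      refine Finset.sum_congr rfl fun j _ => ?_
      rw [Finset.mul_sum]
      refine Finset.sum_congr rfl fun u _ => ?_
      ring
    have hs := Finset.sum_congr rfl fun i (_ : i ∈ (univ : Finset ι)) => hrows i
    rw [Finset.sum_add_distrib, Finset.sum_add_distrib, hb, sum_mulVec_eq_zero_of_colsum A hA,
      sum_mulVec_eq_zero_of_colsum A hA, add_zero, zero_add] at hs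
    exact hs.symm
  -- some q i = 1
  obtain ⟨i, hi⟩ : ∃ i, q i = 1 := by
    by_contra hno
    push Not at hno
    have : ∑ i, q i = 0 := Finset.sum_eq_zero fun i _ => by
      rcases (by decide : ∀ x : ZMod 2, x = 0 ∨ x = 1) (q i) with h | h
      · exact h
      · exact absurd h (hno i)
    rw [this] at hsumq
    exact zero_ne_one hsumq
  -- off W_i, row i of A N is 1
  set U : Finset V := univ.filter fun u => P i u = 0 with hU
  have hUcard : Fintype.card V ≤ U.card + w := by
    have hsplit := Finset.card_filter_add_card_filter_not (s := (univ : Finset V))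
      (p := fun u => P i u = 0)
    rw [Finset.card_univ] at hsplit
    have hWi := hW i
    have hU' : U.card = (univ.filter fun u => P i u = 0).card := rfl
    have hne : (univ.filter fun u => ¬ P i u = 0).card =
        (univ.filter fun u => P i u ≠ 0).card := rfl
    omega
  set S : Finset κ := univ.filter fun j => A i j ≠ 0 with hSdef
  set T : κ → Finset V := fun j => univ.filter fun u => N j u ≠ 0 with hT
  have hUsub : U ⊆ S.biUnion T := by
    intro u hu
    simp only [hU, mem_filter, mem_univ, true_and] at hu
    have hANiu : (A * N) i u = 1 := by
      have := hP i u
      rw [hu, hi] at this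
      rcases (by decide : ∀ x : ZMod 2, x = 0 ∨ x = 1) ((A * N) i u) with h0 | h1
      · rw [h0] at this; exact absurd this.symm (by decide)
      · exact h1
    -- a nonzero sum has a nonzero term
    have hex : ∃ j, A i j * N j u ≠ 0 := by
      by_contra hno
      push Not at hno
      have : (A * N) i u = 0 := by
        rw [Matrix.mul_apply]; exact Finset.sum_eq_zero fun j _ => hno j
      rw [this] at hANiu; exact zero_ne_one hANiu
    obtain ⟨j, hj⟩ := hex
    simp only [mem_biUnion, hSdef, hT, mem_filter, mem_univ, true_and]
    exact ⟨j, left_ne_zero_of_mul hj, right_ne_zero_of_mul hj⟩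
  -- hence |U| ≤ Σ_{j ∈ S} |T j| ≤ |S| · max ≤ ℓ · max
  have hSne : S.Nonempty := by
    rw [Finset.nonempty_iff_ne_empty]
    intro hSe
    rw [hSe, Finset.biUnion_empty] at hUsub
    have : U.card = 0 := by simpa using Finset.card_le_card hUsub
    omega
  obtain ⟨j, hjS, hjmax⟩ := Finset.exists_max_image S (fun j => (T j).card) hSne
  refine ⟨j, ?_⟩
  have h1 : U.card ≤ ∑ j' ∈ S, (T j').card := le_trans (card_le_card hUsub) card_biUnion_le
  have h2 : ∑ j' ∈ S, (T j').card ≤ S.card * (T j).card := by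
    have h2' := Finset.sum_le_card_nsmul S (fun j' => (T j').card) _ hjmax
    rw [smul_eq_mul] at h2'
    exact h2'
  have h3 : S.card * (T j).card ≤ ℓ * (T j).card := Nat.mul_le_mul_right _ (hrow i)
  show Fintype.card V ≤ ℓ * (T j).card + w
  omega

/-- **Barrier II with normalisation.** As `potentialForm_exists_large_row`, for a substitution
matrix `N` given up to the ambiguity `N ↦ N'` with `N' B = N B` (which does not change the
substitution `x ↦ N B y + c`): if moreover `𝟙 ᵥ* B = 0`, there is such an `N'` all of whose rows
are supported on at most half of `V` and one of whose rows is supported on at least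
`(|V| − w)/ℓ` vertices — the input to the edge-isoperimetric inequality of the host graph. -/
theorem potentialForm_exists_balanced_large_row [Fintype ι] [Fintype κ] [Fintype V]
    [DecidableEq V]
    (A : Matrix ι κ (ZMod 2)) (b : ι → ZMod 2)
    (c : κ → ZMod 2) (B : Matrix V Eh (ZMod 2)) (ch : V → ZMod 2) (P : Matrix ι V (ZMod 2))
    (N : Matrix κ V (ZMod 2)) (ℓ w : ℕ)
    (hA : ∀ j, ∑ i, A i j = 0) (hb : ∑ i, b i = 1) (hch : ∑ u, ch u = 1)
    (hconn : ∀ d : V → ZMod 2, d ᵥ* B = 0 → ∀ u v, d u = d v)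
    (hBcol : ∀ e, ∑ u, B u e = 0)
    (hCF1 : A * N * B = P * B) (hCF2 : b + A *ᵥ c = P *ᵥ ch)
    (hrow : ∀ i, (univ.filter fun j => A i j ≠ 0).card ≤ ℓ)
    (hW : ∀ i, (univ.filter fun u => P i u ≠ 0).card ≤ w)
    (hV : w < Fintype.card V) :
    ∃ N' : Matrix κ V (ZMod 2), N' * B = N * B ∧
      (∀ j, 2 * (univ.filter fun u => N' j u ≠ 0).card ≤ Fintype.card V) ∧
      ∃ j, Fintype.card V ≤ ℓ * (univ.filter fun u => N' j u ≠ 0).card + w := by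
  obtain ⟨N', hN'B, hhalf⟩ := halfNormalise B N hBcol
  refine ⟨N', hN'B, hhalf, ?_⟩
  refine potentialForm_exists_large_row A b c B ch P N' ℓ w hA hb hch hconn ?_ hCF2 hrow hW hV
  rw [Matrix.mul_assoc, hN'B, ← Matrix.mul_assoc, hCF1]

/-! ### Graphs: the incidence matrix of a connected graph has the algebraic properties used -/

/-- Every column of an incidence matrix over `ZMod 2` sums to zero (an edge has two ends; a
non-edge column vanishes). This is hypothesis `hBcol` of `halfNormalise`. -/
theorem sum_incMatrix_col_eq_zero [Fintype V] [DecidableEq V] (H : SimpleGraph V)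
    [DecidableRel H.Adj] (e : Sym2 V) : ∑ u, H.incMatrix (ZMod 2) u e = 0 := by
  by_cases he : e ∈ H.edgeSet
  · rw [H.sum_incMatrix_apply_of_mem_edgeSet he]; decide
  · exact H.sum_incMatrix_apply_of_notMem_edgeSet he

/-- For a connected graph, a vertex vector annihilating the incidence matrix from the left
(`d ᵥ* B = 0`, i.e. `d u + d v = 0` across every edge) is constant. This is hypothesis `hconn` of
`potentialForm_exists_large_row`. -/
theorem incMatrix_vecMul_eq_zero_const [Fintype V] [DecidableEq V] (H : SimpleGraph V)
    [DecidableRel H.Adj] (hH : H.Connected) (d : V → ZMod 2)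
    (hd : d ᵥ* H.incMatrix (ZMod 2) = 0) (u v : V) : d u = d v := by
  have hadj : ∀ a b, H.Adj a b → d a = d b := by
    intro a b hab
    have he := congrFun hd s(a, b)
    simp only [Matrix.vecMul, dotProduct, Pi.zero_apply] at he
    have hsum : ∑ x, d x * H.incMatrix (ZMod 2) x s(a, b) = d a + d b := by
      have hx : ∀ x, d x * H.incMatrix (ZMod 2) x s(a, b) = if x = a ∨ x = b then d x else 0 := by
        intro x
        simp only [SimpleGraph.incMatrix_apply', SimpleGraph.mk'_mem_incidenceSet_iff]
        by_cases hx : x = a ∨ x = b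
        · simp [hx, hab]
        · simp [hx]
      rw [Finset.sum_congr rfl fun x _ => hx x, Finset.sum_ite, Finset.sum_const_zero, add_zero]
      have hfil : (univ.filter fun x => x = a ∨ x = b) = {a, b} := by
        ext x; simp
      rw [hfil, Finset.sum_pair hab.ne]
    rw [hsum] at he
    have h2 := congrArg (· + d b) he
    simpa [add_assoc, CharTwo.add_self_eq_zero] using h2
  obtain ⟨p⟩ := hH.preconnected u v
  induction p with
  | nil => rfl
  | cons h _ ih => exact (hadj _ _ h).trans ih

/-- **Barrier II for graphs.** `potentialForm_exists_balanced_large_row` with `B` the incidence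
matrix over `ZMod 2` of a connected simple graph `H` on `V` (edges indexed by `Sym2 V`; non-edges
are zero columns): the two algebraic hypotheses on `B` are discharged by
`incMatrix_vecMul_eq_zero_const` and `sum_incMatrix_col_eq_zero`. For the `k × k` grid the
conclusion feeds the edge-isoperimetric inequality: a vertex set of size between `(k² − w)/ℓ`
and `k²/2` has at least `min(2√((k²−w)/ℓ), k)` boundary edges, all of which occur in the
substituted image of the single variable `x_j`. -/
theorem potentialForm_exists_balanced_large_row_graph [Fintype ι] [Fintype κ] [Fintype V]
    [DecidableEq V] (H : SimpleGraph V) [DecidableRel H.Adj] (hH : H.Connected)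
    (A : Matrix ι κ (ZMod 2)) (b : ι → ZMod 2) (c : κ → ZMod 2) (ch : V → ZMod 2)
    (P : Matrix ι V (ZMod 2)) (N : Matrix κ V (ZMod 2)) (ℓ w : ℕ)
    (hA : ∀ j, ∑ i, A i j = 0) (hb : ∑ i, b i = 1) (hch : ∑ u, ch u = 1)
    (hCF1 : A * N * H.incMatrix (ZMod 2) = P * H.incMatrix (ZMod 2))
    (hCF2 : b + A *ᵥ c = P *ᵥ ch)
    (hrow : ∀ i, (univ.filter fun j => A i j ≠ 0).card ≤ ℓ)
    (hW : ∀ i, (univ.filter fun u => P i u ≠ 0).card ≤ w)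
    (hV : w < Fintype.card V) :
    ∃ N' : Matrix κ V (ZMod 2), N' * H.incMatrix (ZMod 2) = N * H.incMatrix (ZMod 2) ∧
      (∀ j, 2 * (univ.filter fun u => N' j u ≠ 0).card ≤ Fintype.card V) ∧
      ∃ j, Fintype.card V ≤ ℓ * (univ.filter fun u => N' j u ≠ 0).card + w :=
  potentialForm_exists_balanced_large_row A b c (H.incMatrix (ZMod 2)) ch P N ℓ w hA hb hch
    (incMatrix_vecMul_eq_zero_const H hH) (sum_incMatrix_col_eq_zero H) hCF1 hCF2 hrow hW hV

end SubstitutionBarrier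

end Summit.PneNP.PneNP.Theorems
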